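import Summits.QuantumFields.BalabanUV.T4Continuum.Support.VariationalVectorFederbushSum

/-!
# T⁴ programme, spine node NE2 (U1a), lane P2 — THE LINE-SUM AVERAGE CONTRACTS THE `ℓ²` SIZE: `Σ_{y,μ}‖Q_T W(y,μ)‖² ≤ n^{−d}·Σ_{x,μ}‖W(x,μ)‖²`
# (Jensen on the `n^{d+1}` line points with contractive line transports; in the road owner's letters `nsqV M (QvL T W) ≤ qWV n M W`), and `QvL` is continuous
# (`t4/skeletons/NE2-t4-ne2-p2.md` v0.15 §2.E — bookkeeping binders of `vector_pair_bracket_sqrt` ∕ `towerLimitRate_effV` for the LINE-indexed carrier; cell `pub-balaban`)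

NE2 formalisation swarm `b2b-balaban-t4-ne2-formalise-*`, leaf prover 01 GEN 5 (`prover-b2b-balaban-t4-ne2-formalise-leaf-01-g5-0`).  On top of leaf-03-g4's `QvL`
(`VectorLineTransport`, p216509), `nsqV` (p215552), the owner's `qWV` (`VariationalVectorForm`, p216339) and this lineage's counting lemmas
`VariationalVectorFederbush.{card_digits, sq_sum_fin_le}` (p216754) — BY NAME; no definition.
 * `norm_QvL_le` — `‖Q_T W(y,μ)‖ ≤ n^{−(d+1)}·Σ_j Σ_t ‖W(n·y+j+te_μ, μ)‖` for contractive line transports;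
 * `sum_sq_QvL_le` — `Σ_y ‖Q_T W(y,μ)‖² ≤ n^{−d}·Σ_x ‖W(x,μ)‖²` (Cauchy–Schwarz over the `n^{d+1}` line points; each fine bond lies on `n` lines: `sum_blocks_translate`);
 * **`nsqV_QvL_le`** — `nsqV M (QvL n M T W) ≤ n^{−d}·nsqV (fine n M) W`, i.e. **`nsqV_QvL_le_qWV`**: `nsqV M (QvL n M T W) ≤ qWV n M W` — the unit-lattice `ℓ²` size of
   the average is at most the physical `ℓ²` size of the field (the 1-form twin of `VariationalCovariantScalarForm.nsq_Qmat_mulVec_le`; used wherever a zeroth-order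
   term or the END's `‖W‖² ≤ (nL)^d·qWV` step meets the averaged field);
 * `continuous_QvL` — the `hQk`∕`hQ₁` binder of `vector_pair_bracket_sqrt` for the line-indexed carrier (the bond-indexed `continuous_QvT` is the owner's).
WHAT IS NOT HERE: surjectivity of `QvL` for line-indexed transports (leaf-03-g4's V-UB-L `exists_corrected`), anything about forms.

HONEST FRAMING (T4-DAG p. 1).  Model level; transports DATA; [folklore] Jensen ∕ Cauchy–Schwarz + block bijection; nothing printed is a hypothesis; no `def`, no
`def … : Prop`, no `sorry`; axioms standard.  NE2 NOT proved; spine PROVED 0∕9 unchanged; rung (B)+1 finite T⁴ — NOT infinite volume, NOT mass gap, NOT Clay.  HONEST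
DEPENDENCY (cell, verbatim): continuum YM on T⁴ ⇐ BetaPertH ∧ nine spine estimates (0/9 proved); BetaPertH ⇐ (D1) ∧ (D4) ∧ CAP+tail; G-an2-4 gates asym, D1 and NE2/3/4.
-/

noncomputable section

namespace Summit.QuantumFields.BalabanUV.T4Continuum.VariationalVectorAverage

open Finset
open Literature.MathematicalPhysics.QuantumFieldTheory.Balaban1983to89
open Literature.MathematicalPhysics.QuantumFieldTheory.Balaban1983to89.B5Prop11Plancherel (Tor fine unitVec)
open Literature.MathematicalPhysics.QuantumFieldTheory.Balaban1983to89.B5Block118 (tstep bpt)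
open Summit.QuantumFields.BalabanUV.T4Continuum.VariationalCovariantFederbush (sq_sum_le_card_mul sum_blocks_translate)
open Summit.QuantumFields.BalabanUV.T4Continuum.VectorBlockTrialForm (nsqV nsqV_nonneg QvL)
open Summit.QuantumFields.BalabanUV.T4Continuum.VariationalVectorForm (qWV)
open Summit.QuantumFields.BalabanUV.T4Continuum.VariationalVectorFederbush (card_digits sq_sum_fin_le norm_invPow)

variable {d : ℕ} {E : Type*} [NormedAddCommGroup E] [NormedSpace ℂ E]
variable (n : ℕ) [NeZero n] (M : Fin d → ℕ) [hM : ∀ μ, NeZero (M μ)]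
variable {T : Tor M → (Fin d → Fin n) → Fin n → Fin d → (E →L[ℂ] E)}

omit [NeZero n] hM in
/-- **JENSEN, POINTWISE**: `‖Q_T W(y,μ)‖ ≤ n^{−(d+1)}·Σ_j Σ_t ‖W(n·y + j + t e_μ, μ)‖` for contractive line transports. [folklore] -/
theorem norm_QvL_le (hT : ∀ y j t μ, ‖T y j t μ‖ ≤ 1) (W : Tor (fine n M) → Fin d → E) (y : Tor M) (μ : Fin d) :
    ‖QvL n M T W y μ‖ ≤ ((n : ℝ) ^ (d + 1))⁻¹ * ∑ j : Fin d → Fin n, ∑ t : Fin n, ‖W (bpt n M y j + tstep (fine n M) μ t) μ‖ := by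
  unfold QvL
  rw [norm_smul, norm_invPow]
  refine mul_le_mul_of_nonneg_left ((norm_sum_le _ _).trans (sum_le_sum fun j _ => (norm_sum_le _ _).trans (sum_le_sum fun t _ => ?_)))
    (by positivity)
  calc _ ≤ ‖T y j t μ‖ * ‖W (bpt n M y j + tstep (fine n M) μ t) μ‖ := ContinuousLinearMap.le_opNorm _ _
    _ ≤ 1 * _ := mul_le_mul_of_nonneg_right (hT _ _ _ _) (norm_nonneg _)
    _ = _ := one_mul _

/-- **JENSEN, SUMMED PER COMPONENT**: `Σ_y ‖Q_T W(y,μ)‖² ≤ n^{−d}·Σ_x ‖W(x,μ)‖²` — Cauchy–Schwarz over the `n^{d+1}` line points of a block, and every fine point lies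
on exactly `n` of the lines (one per position `t`: `sum_blocks_translate`). [folklore] -/
theorem sum_sq_QvL_le (hT : ∀ y j t μ, ‖T y j t μ‖ ≤ 1) (W : Tor (fine n M) → Fin d → E) (μ : Fin d) :
    ∑ y, ‖QvL n M T W y μ‖ ^ 2 ≤ ((n : ℝ) ^ d)⁻¹ * ∑ x, ‖W x μ‖ ^ 2 := by
  have hn : (0 : ℝ) < n := by exact_mod_cast Nat.pos_of_ne_zero (NeZero.ne n)
  -- Cauchy–Schwarz per block
  have hcs : ∀ y : Tor M, (∑ j : Fin d → Fin n, ∑ t : Fin n, ‖W (bpt n M y j + tstep (fine n M) μ t) μ‖) ^ 2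
      ≤ (n : ℝ) ^ d * n * ∑ j : Fin d → Fin n, ∑ t : Fin n, ‖W (bpt n M y j + tstep (fine n M) μ t) μ‖ ^ 2 := by
    intro y
    calc _ ≤ (n : ℝ) ^ d * ∑ j : Fin d → Fin n, (∑ t : Fin n, ‖W (bpt n M y j + tstep (fine n M) μ t) μ‖) ^ 2 := by
          have h := sq_sum_le_card_mul Finset.univ (fun j : Fin d → Fin n => ∑ t : Fin n, ‖W (bpt n M y j + tstep (fine n M) μ t) μ‖)
          rwa [card_digits] at h
      _ ≤ (n : ℝ) ^ d * ∑ j : Fin d → Fin n, ((n : ℝ) * ∑ t : Fin n, ‖W (bpt n M y j + tstep (fine n M) μ t) μ‖ ^ 2) := by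
          gcongr with j _
          exact sq_sum_fin_le n _
      _ = _ := by simp only [← mul_sum]; ring
  -- every fine point on `n` lines
  have hcount : ∑ y : Tor M, ∑ j : Fin d → Fin n, ∑ t : Fin n, ‖W (bpt n M y j + tstep (fine n M) μ t) μ‖ ^ 2 = n * ∑ x, ‖W x μ‖ ^ 2 := by
    calc ∑ y : Tor M, ∑ j : Fin d → Fin n, ∑ t : Fin n, ‖W (bpt n M y j + tstep (fine n M) μ t) μ‖ ^ 2
        = ∑ t : Fin n, ∑ y : Tor M, ∑ j : Fin d → Fin n, ‖W (bpt n M y j + tstep (fine n M) μ t) μ‖ ^ 2 := by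
          calc _ = ∑ y : Tor M, ∑ t : Fin n, ∑ j : Fin d → Fin n, ‖W (bpt n M y j + tstep (fine n M) μ t) μ‖ ^ 2 :=
                sum_congr rfl fun y _ => Finset.sum_comm
            _ = _ := Finset.sum_comm
      _ = ∑ _t : Fin n, ∑ x, ‖W x μ‖ ^ 2 := sum_congr rfl fun t _ => sum_blocks_translate n M (fun x => ‖W x μ‖ ^ 2) (tstep (fine n M) μ t)
      _ = _ := by rw [sum_const, Finset.card_univ, Fintype.card_fin, nsmul_eq_mul]
  calc ∑ y, ‖QvL n M T W y μ‖ ^ 2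
      ≤ ∑ y : Tor M, (((n : ℝ) ^ (d + 1))⁻¹ * ∑ j : Fin d → Fin n, ∑ t : Fin n, ‖W (bpt n M y j + tstep (fine n M) μ t) μ‖) ^ 2 :=
        sum_le_sum fun y _ => pow_le_pow_left₀ (norm_nonneg _) (norm_QvL_le n M hT W y μ) 2
    _ ≤ ∑ y : Tor M, (((n : ℝ) ^ (d + 1))⁻¹) ^ 2 * ((n : ℝ) ^ d * n * ∑ j : Fin d → Fin n, ∑ t : Fin n, ‖W (bpt n M y j + tstep (fine n M) μ t) μ‖ ^ 2) := by
        refine sum_le_sum fun y _ => ?_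
        rw [mul_pow]
        exact mul_le_mul_of_nonneg_left (hcs y) (sq_nonneg _)
    _ = (((n : ℝ) ^ (d + 1))⁻¹) ^ 2 * ((n : ℝ) ^ d * n * (n * ∑ x, ‖W x μ‖ ^ 2)) := by rw [← mul_sum, ← mul_sum, hcount]
    _ = _ := by field_simp; ring

/-- **THE LINE-SUM AVERAGE CONTRACTS THE `ℓ²` SIZE** (lattice units): `nsqV M (Q_T W) ≤ n^{−d}·nsqV (fine n M) W`. [folklore] -/
theorem nsqV_QvL_le (hT : ∀ y j t μ, ‖T y j t μ‖ ≤ 1) (W : Tor (fine n M) → Fin d → E) :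
    nsqV M (QvL n M T W) ≤ ((n : ℝ) ^ d)⁻¹ * nsqV (fine n M) W := by
  unfold nsqV
  calc ∑ y, ∑ μ, ‖QvL n M T W y μ‖ ^ 2 = ∑ μ, ∑ y, ‖QvL n M T W y μ‖ ^ 2 := Finset.sum_comm
    _ ≤ ∑ μ, ((n : ℝ) ^ d)⁻¹ * ∑ x, ‖W x μ‖ ^ 2 := sum_le_sum fun μ _ => sum_sq_QvL_le n M hT W μ
    _ = ((n : ℝ) ^ d)⁻¹ * ∑ x, ∑ μ, ‖W x μ‖ ^ 2 := by rw [← mul_sum, Finset.sum_comm]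

/-- **IN THE ROAD OWNER'S LETTERS**: `nsqV M (QvL n M T W) ≤ qWV n M W` — the unit-lattice `ℓ²` size of the transported (1.18) average is at most the physical `ℓ²`
size of the level-`n` field. [folklore] -/
theorem nsqV_QvL_le_qWV (hT : ∀ y j t μ, ‖T y j t μ‖ ≤ 1) (W : Tor (fine n M) → Fin d → E) : nsqV M (QvL n M T W) ≤ qWV n M W :=
  nsqV_QvL_le n M hT W

omit [NeZero n] hM in
/-- `Q_T` is continuous in the field (a finite sum of continuous linear maps applied to coordinates). [folklore] -/
theorem continuous_QvL (T : Tor M → (Fin d → Fin n) → Fin n → Fin d → (E →L[ℂ] E)) : Continuous (QvL n M T) := by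
  refine continuous_pi fun y => continuous_pi fun μ => ?_
  unfold QvL
  refine continuous_const.smul (continuous_finsetSum _ fun j _ => continuous_finsetSum _ fun t _ => ?_)
  exact (T y j t μ).continuous.comp ((continuous_apply μ).comp (continuous_apply _))

end Summit.QuantumFields.BalabanUV.T4Continuum.VariationalVectorAverage

end
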